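import Literature.Barriers.CriticalPhenomena.GridSAWTowers
import HarnessLib

/-!
# Barrier `GridSAWCountingSharpPComplete`, tower step: the instance map `R₁(x) = (E₂, τ, h)` as a
# string function, its correctness on ALL strings, and the reduction of
# `LOT2003_thm7_fixedLength_towers` to one machine fact

Sibling of `GridSAWCountingViaGridHamPath.lean` (the pivot `GRIDHAMPATHCOUNT` — `#HamPath` for
graphs of maximum degree three presented with a congestion-free grid drawing `(P, D, s, t)` —
and the named sub-fact `LOT2003_thm7_fixedLength_towers : GRIDHAMPATHCOUNT ≤ᵖ_{parsimonious}
SAWCOUNT₁` of Liśkiewicz–Ogihara–Toda 2003, Theorem 7 (1)), `GridSAWTowers.lean` ((T1): the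
uniformised drawing `uniformize P D = (P₂, D₂)`, every edge realised by a path of `24Λ² + 1`
points, and the counting identity `hamPathCount_eq_sawCountFixedLength_uniformize`) and
`GridSAWUniformDrawingCount.lean` ((T2)). The tower step has a machine-free part — there is an
instance of `SAWCOUNT₁` with the same count — and a machine part — the instance is computed in
polynomial time. This file closes the machine-free part down to the level of STRINGS and isolates
the machine part as a single membership statement:

> "Let `τ` in `E₂` be the image of `t′`. Define `R₁(x) = (E₂, τ, h)`. … Then the pair `(R₁, R₃)`
> witnesses that the types 1–3 of the counting problem of SAWs in two-dimensional grids are each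
> `#P`-complete under `≤ᵖ_{r-shift}`-reductions." [LOT2003, §4, proof of Theorem 7, PDF p. 11]

## What is formalised (namespace `Literature.Barriers.CriticalPhenomena.GridSAW`)

* `towerInstance P D s t : EdgeList × GridPoint × ℕ` — **the instance `(E₂ - P₂[s], P₂[t] - P₂[s],
  24Λ²(N-1))` of version (1)** for a valid presentation (`IsGridDrawing P D`, `s, t < N = |P|`,
  `N ≥ 2`), the fixed one-walk instance `oneWalkInstance` for the one-vertex graph (`N = 1`:
  `D = []`, `s = t = 0`, exactly one Hamiltonian path `[0]`, `hamPathCount_one_nil`; excluded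
  from (T1)/(T2), whose realised subgraph is empty there), and the fixed walk-free instance
  `noWalkInstance` (`[]`, no vertex at all: `sawCountFixedLength_nil`) for invalid presentations;
* `sawCountFixedLength_towerInstance`: **its version-(1) count is `GRIDHAMPATHCOUNT` of the
  presentation**, in all cases; `isGridSubgraph_towerInstance`;
* `towerCode : List Bool → List Bool` — `R₁` on strings: decode with the pivot's
  `encodingDrawnGraphInstance`, apply `towerInstance`, encode with the barrier's
  `encodingFixedLengthInstance` — and **`SAWCOUNT₁_towerCode : SAWCOUNT₁ (towerCode w) =
  GRIDHAMPATHCOUNT w` for every string `w`** (both counting functions read their input through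
  `decode`, so non-canonical codes need no separate treatment here);
* the remaining machine content as a named fact, `LOT2003_thm7_fixedLength_towers_FP :
  towerCode ∈ FP`, and the PROVED reductions `LOT2003_thm7_fixedLength_towers_of_FP`
  (`towerCode ∈ FP → LOT2003_thm7_fixedLength_towers`) and, more flexibly for the machine
  builder, `LOT2003_thm7_fixedLength_towers_of_mem_FP`: ANY `R ∈ FP` whose outputs have the same
  `SAWCOUNT₁`-values as `towerCode`'s (another edge order, another code of the same instance, …)
  discharges the tower step.

## What remains, and its shape (T3)

`towerCode ∈ FP` is a programming task in the tree's `TM2`-based `FP`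
(`Literature.Computability.Complexity.FP`), to be assembled from the brick toolkit
(`Literature/Computability/Complexity/`: `BrickAlgebra`, `ListFoldBricks`, `ListFoldChecks`,
`CanonicalCodes`, `ZIntBricks`, `HashBricks.nthItemFn`, …): (a) a total closed form of
`encodingDrawnGraphInstance.decode` (all component decoders are total) and the canonical
re-encoding of its NESTED list codes (`CanonicalCodes.canonListFn` is the flat case); (b) a
one-bit brick deciding `IsGridDrawing P D ∧ s, t < |P|` on canonical codes (distinctness,
per-edge checks with index look-ups, pairwise edge checks, degrees); (c) the generator of
`uniformize` (`maxEdges`, then per edge `newPath`: `runWithTowers` on the first unit edge,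
`scalePath` on the rest, as consecutive translated pairs = `translate (-P₂[s]) (drawnEdges D₂)`)
with `ZIntBricks` arithmetic, and the final `encodingFixedLengthInstance` code (unary edge count
`|D| · 24Λ²`). The author of this file (tenure on the sub-fact) builds these bottom-up in
`Literature/Computability/Complexity/` and `…/CriticalPhenomena/GridSAWTowersMachine*.lean`.

## References

* M. Liśkiewicz, M. Ogihara, S. Toda, *The complexity of counting self-avoiding walks in
  subgraphs of two-dimensional grids and hypercubes*, TCS 304 (2003) 129–156, §4, proof of
  Theorem 7 ("Define `R₁(x) = (E₂, τ, h)`"), §2.2 (`≤ᵖ_{parsimonious}`, `≤ᵖ_{r-shift}`: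
  polynomial-time instance maps).
* S. Arora, B. Barak, *Computational Complexity: A Modern Approach*, CUP 2009, §0.1 (codes),
  §17.3.1 (parsimonious reductions).
-/

noncomputable section

namespace Literature.Barriers.CriticalPhenomena.GridSAW

open _root_.Computability Literature.Computability.Complexity

/-! ### Two fixed instances -/

/-- The walk-free instance `([], (0,0), 0)`: the empty subgraph has no vertex, hence no
self-avoiding walk of any length (`sawCountFixedLength_nil`); the image of every invalid
presentation. [folklore] -/
def noWalkInstance : EdgeList × GridPoint × ℕ := ([], (0, 0), 0)

/-- The one-walk instance: the one-edge graph `{(0,0) — (0,1)}`, end point `(0,1)`, length `1`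
(exactly one walk, `sawCountFixedLength_oneWalkInstance`); the image of the one-vertex graph,
whose unique Hamiltonian path `[0]` has no counterpart walk in its (empty) realised subgraph.
[folklore] -/
def oneWalkInstance : EdgeList × GridPoint × ℕ := ([((0, 0), (0, 1))], (0, 1), 1)

/-- The empty subgraph has no self-avoiding walk between any points, of any length (a walk has a
point, which must be a vertex). [folklore] -/
theorem sawCountFixedLength_nil (t : GridPoint) (n : ℕ) : sawCountFixedLength [] t n = 0 := by
  rw [sawCountFixedLength]
  convert Set.ncard_empty (List GridPoint)
  ext ω
  simp only [Set.mem_setOf_eq, Set.mem_empty_iff_false, iff_false, not_and]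
  rintro ⟨⟨hne, -, hmem, -⟩, -, -⟩
  obtain ⟨p, hp⟩ := List.exists_mem_of_ne_nil ω hne
  have := hmem p hp
  simp [vertexSet] at this

/-- The one-walk instance has exactly one walk (the sibling's `sawCountFixedLength_oneEdge`, with
the translation by `-(0,0)` computed). [folklore] -/
theorem sawCountFixedLength_oneWalkInstance :
    sawCountFixedLength oneWalkInstance.1 oneWalkInstance.2.1 oneWalkInstance.2.2 = 1 := by
  have h := sawCountFixedLength_oneEdge
  simp only [translate, List.map_cons, List.map_nil] at h
  exact h

/-- The one-walk instance is a subgraph of the grid. [folklore] -/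
theorem isGridSubgraph_oneWalkInstance : IsGridSubgraph oneWalkInstance.1 :=
  isGridSubgraph_singleEdge

/-! ### `GRIDHAMPATHCOUNT` through codes -/

/-- `GRIDHAMPATHCOUNT` vanishes on the code of a presentation that is not a valid drawing with
both end vertices in range. [cite: LiskiewiczOgiharaToda2003, §2.3 (#HamPath) and §4 (proof of Theorem 7, E₀)] -/
theorem GRIDHAMPATHCOUNT_encode_eq_zero (P : List GridPoint) (D : List DrawnEdge) (s t : ℕ)
    (h : ¬ (IsGridDrawing P D ∧ s < P.length ∧ t < P.length)) :
    GRIDHAMPATHCOUNT (encodingDrawnGraphInstance.encode (P, D, s, t)) = 0 := by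
  simp only [GRIDHAMPATHCOUNT, encodingDrawnGraphInstance.decode_encode]
  rw [if_neg h]

/-- `GRIDHAMPATHCOUNT` reads its input through `decode`: on a string decoding to `(P, D, s, t)`
it takes the value it takes on the canonical code of `(P, D, s, t)`. [folklore] -/
theorem GRIDHAMPATHCOUNT_of_decode_eq_some {w : List Bool} {P : List GridPoint}
    {D : List DrawnEdge} {s t : ℕ} (h : encodingDrawnGraphInstance.decode w = some (P, D, s, t)) :
    GRIDHAMPATHCOUNT w = GRIDHAMPATHCOUNT (encodingDrawnGraphInstance.encode (P, D, s, t)) := by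
  simp only [GRIDHAMPATHCOUNT, h, encodingDrawnGraphInstance.decode_encode]

/-- `GRIDHAMPATHCOUNT` vanishes on strings that are not codes. [folklore] -/
theorem GRIDHAMPATHCOUNT_of_decode_eq_none {w : List Bool}
    (h : encodingDrawnGraphInstance.decode w = none) : GRIDHAMPATHCOUNT w = 0 := by
  simp only [GRIDHAMPATHCOUNT, h]

/-! ### The one-vertex graph -/

/-- A valid drawing on one vertex has no edge (an edge needs two distinct end vertices).
[folklore] -/
theorem eq_nil_of_isGridDrawing_of_length_eq_one {P : List GridPoint} {D : List DrawnEdge}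
    (hD : IsGridDrawing P D) (h1 : P.length = 1) : D = [] := by
  rcases D with _ | ⟨e, D⟩
  · rfl
  · exfalso
    obtain ⟨h₁, h₂, hne, -⟩ := hD.2.1 e List.mem_cons_self
    omega

/-- The one-vertex graph has exactly one Hamiltonian `0`–`0` path, `[0]`. [folklore] -/
theorem hamPathCount_one_nil : hamPathCount 1 [] 0 0 = 1 := by
  rw [hamPathCount, Set.ncard_eq_one]
  refine ⟨[0], Set.eq_singleton_iff_unique_mem.mpr
    ⟨⟨by decide, rfl, rfl, List.IsChain.singleton _⟩, ?_⟩⟩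
  rintro l ⟨hperm, -, -, -⟩
  exact List.perm_singleton.mp hperm

/-! ### The instance map on presentations -/

/-- **The instance map of the tower step on presentations `(P, D, s, t)`** ("Define
`R₁(x) = (E₂, τ, h)`"): for a valid drawing with `s, t < N = |P|` and `N ≥ 2`, the realised
subgraph `E₂ = drawnEdges D₂` of the uniformised drawing `(P₂, D₂) = uniformize P D`
(`GridSAWTowers.lean`) shifted so that the image of `s` is the origin, the shifted image `τ` of
`t`, and the length `h = 24Λ² (N - 1)` (every edge of `D₂` has `24Λ²` unit edges, a Hamiltonian
path has `N - 1` edges); for `N = 1` the one-walk instance; for invalid presentations the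
walk-free instance. [cite: LiskiewiczOgiharaToda2003, §4 (proof of Theorem 7: "Define R₁(x) = (E₂, τ, h)", h = L²(N+1) for the N+2 nodes of G′)] -/
def towerInstance (P : List GridPoint) (D : List DrawnEdge) (s t : ℕ) :
    EdgeList × GridPoint × ℕ :=
  if IsGridDrawing P D ∧ s < P.length ∧ t < P.length then
    if P.length = 1 then oneWalkInstance
    else
      (translate (-(img (uniformize P D).1 s)) (drawnEdges (uniformize P D).2),
        img (uniformize P D).1 t - img (uniformize P D).1 s,
        24 * maxEdges D * maxEdges D * (P.length - 1))
  else noWalkInstance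

section Instance

variable (P : List GridPoint) (D : List DrawnEdge) (s t : ℕ)

/-- `towerInstance` on an invalid presentation. [folklore] -/
theorem towerInstance_of_not (h : ¬ (IsGridDrawing P D ∧ s < P.length ∧ t < P.length)) :
    towerInstance P D s t = noWalkInstance := by
  unfold towerInstance
  rw [if_neg h]

/-- `towerInstance` on the one-vertex graph. [folklore] -/
theorem towerInstance_of_length_eq_one (h : IsGridDrawing P D ∧ s < P.length ∧ t < P.length)
    (h1 : P.length = 1) : towerInstance P D s t = oneWalkInstance := by
  unfold towerInstance
  rw [if_pos h, if_pos h1]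

/-- `towerInstance` in the main case. [folklore] -/
theorem towerInstance_of_ne_one (h : IsGridDrawing P D ∧ s < P.length ∧ t < P.length)
    (h1 : P.length ≠ 1) :
    towerInstance P D s t =
      (translate (-(img (uniformize P D).1 s)) (drawnEdges (uniformize P D).2),
        img (uniformize P D).1 t - img (uniformize P D).1 s,
        24 * maxEdges D * maxEdges D * (P.length - 1)) := by
  unfold towerInstance
  rw [if_pos h, if_neg h1]

/-- **The instance is a subgraph of the two-dimensional grid** (so `SAWCOUNT₁` counts its
walks). [cite: LiskiewiczOgiharaToda2003, §4 (proof of Theorem 7: E₂ "a subgraph of a two-dimensional grid")] -/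
theorem isGridSubgraph_towerInstance : IsGridSubgraph (towerInstance P D s t).1 := by
  by_cases h : IsGridDrawing P D ∧ s < P.length ∧ t < P.length
  · by_cases h1 : P.length = 1
    · rw [towerInstance_of_length_eq_one P D s t h h1]
      exact isGridSubgraph_oneWalkInstance
    · rw [towerInstance_of_ne_one P D s t h h1]
      exact isGridSubgraph_uniformize h.1 _
  · rw [towerInstance_of_not P D s t h]
    intro e he
    simp [noWalkInstance] at he

/-- **Correctness of the instance map on presentations**: the version-(1) count of
`towerInstance P D s t` — walks of the instance's subgraph from the origin to its end point with
its length — is `GRIDHAMPATHCOUNT` of the (code of the) presentation: the number of Hamiltonian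
`s`–`t` paths for a valid drawing with `s, t` in range (by (T1)+(T2),
`hamPathCount_eq_sawCountFixedLength_uniformize`, for `N ≥ 2`; by `hamPathCount_one_nil` for
`N = 1`), and `0` otherwise. [cite: LiskiewiczOgiharaToda2003, Theorem 7 (proof: "the number of SAWs in E₂ having length h is exactly the number of Hamiltonian paths in G′")] -/
theorem sawCountFixedLength_towerInstance :
    sawCountFixedLength (towerInstance P D s t).1 (towerInstance P D s t).2.1
        (towerInstance P D s t).2.2 =
      GRIDHAMPATHCOUNT (encodingDrawnGraphInstance.encode (P, D, s, t)) := by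
  by_cases h : IsGridDrawing P D ∧ s < P.length ∧ t < P.length
  · obtain ⟨hD, hs, ht⟩ := h
    rw [GRIDHAMPATHCOUNT_encode P D s t hD hs ht]
    by_cases h1 : P.length = 1
    · rw [towerInstance_of_length_eq_one P D s t ⟨hD, hs, ht⟩ h1]
      have hs0 : s = 0 := by omega
      have ht0 : t = 0 := by omega
      subst hs0 ht0
      rw [h1, eq_nil_of_isGridDrawing_of_length_eq_one hD h1, hamPathCount_one_nil]
      exact sawCountFixedLength_oneWalkInstance
    · rw [towerInstance_of_ne_one P D s t ⟨hD, hs, ht⟩ h1]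
      have hN : 2 ≤ P.length := by omega
      have hs' : s < (uniformize P D).1.length := by simpa using hs
      have ht' : t < (uniformize P D).1.length := by simpa using ht
      dsimp only
      rw [img_eq_getElem hs', img_eq_getElem ht',
        hamPathCount_eq_sawCountFixedLength_uniformize hD hN hs ht]
  · rw [towerInstance_of_not P D s t h, GRIDHAMPATHCOUNT_encode_eq_zero P D s t h]
    exact sawCountFixedLength_nil _ _

end Instance

/-! ### The instance map on strings and its correctness -/

/-- **`R₁` as a string function**: decode the presentation (the pivot's
`encodingDrawnGraphInstance`), apply `towerInstance`, encode the instance (the barrier's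
`encodingFixedLengthInstance`); non-codes (there are none: all component decoders are total —
immaterial here) go to the walk-free instance. [cite: LiskiewiczOgiharaToda2003, §4 (proof of Theorem 7: "Define R₁(x) = (E₂, τ, h)")] -/
def towerCode (w : List Bool) : List Bool :=
  match encodingDrawnGraphInstance.decode w with
  | some (P, D, s, t) => encodingFixedLengthInstance.encode (towerInstance P D s t)
  | none => encodingFixedLengthInstance.encode noWalkInstance

/-- **Correctness of `R₁` on all strings**: `SAWCOUNT₁ (towerCode w) = GRIDHAMPATHCOUNT w` —
"the number of SAWs in `E₂` having length `h` is exactly the number of Hamiltonian paths in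
`G′`", together with the conventions of the two string functions on invalid inputs.
[cite: LiskiewiczOgiharaToda2003, Theorem 7 (proof, types (1)–(3))] -/
theorem SAWCOUNT₁_towerCode (w : List Bool) : SAWCOUNT₁ (towerCode w) = GRIDHAMPATHCOUNT w := by
  unfold towerCode
  rcases h : encodingDrawnGraphInstance.decode w with _ | ⟨P, D, s, t⟩
  · dsimp only
    rw [GRIDHAMPATHCOUNT_of_decode_eq_none h, SAWCOUNT₁_encode _ _ _ (fun e he => by
      simp [noWalkInstance] at he)]
    exact sawCountFixedLength_nil _ _
  · dsimp only
    rw [GRIDHAMPATHCOUNT_of_decode_eq_some h, ← sawCountFixedLength_towerInstance P D s t]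
    exact SAWCOUNT₁_encode _ _ _ (isGridSubgraph_towerInstance P D s t)

/-! ### The machine fact and the reduction of the tower step to it -/

/-- **The machine half of the tower step** (named fact): the instance map `R₁ = towerCode` is
computable in polynomial time, `towerCode ∈ FP` (the tree's `TM2`-based class
`Literature.Computability.Complexity.FP`). In the source this is the unproved routine part of
"`≤ᵖ_{r-shift}`-reduction" (polynomial-time `R₁`): decoding, the syntactic validity check of the
drawing, `uniformize` (one pass for `Λ`, then runs, towers and translations with integer
arithmetic) and encoding are each polynomial in the input length. To be discharged by a brick
assembly (see the module docstring, (T3)). [cite: LiskiewiczOgiharaToda2003, §2.2 (polynomial-time R₁ in ≤ᵖ_{r-shift} and ≤ᵖ_{parsimonious}) and §4 (proof of Theorem 7: "Define R₁(x) = (E₂, τ, h)")] -/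
def LOT2003_thm7_fixedLength_towers_FP : Prop :=
  towerCode ∈ FP

/-- **The tower step from any polynomial-time realisation of `R₁` up to `SAWCOUNT₁`-value**: if
some `R ∈ FP` produces, on every string, an instance with the same version-(1) count as
`towerCode` (e.g. `towerCode` itself, or a variant listing the edges in another order or writing
another code of the same instance), then `GRIDHAMPATHCOUNT ≤ᵖ_{parsimonious} SAWCOUNT₁`.
[cite: LiskiewiczOgiharaToda2003, Theorem 7 (proof, "the pair (R₁, R₃) witnesses …") and Proposition 1] -/
theorem LOT2003_thm7_fixedLength_towers_of_mem_FP {R : List Bool → List Bool} (hR : R ∈ FP)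
    (h : ∀ w, SAWCOUNT₁ (R w) = SAWCOUNT₁ (towerCode w)) : LOT2003_thm7_fixedLength_towers :=
  ⟨R, hR, fun w => by rw [h w, SAWCOUNT₁_towerCode]⟩

/-- **The tower step, reduced to its machine half**: `towerCode ∈ FP` gives
`LOT2003_thm7_fixedLength_towers` (with `R₁ = towerCode` and `SAWCOUNT₁_towerCode`).
[cite: LiskiewiczOgiharaToda2003, Theorem 7 (proof, types (1)–(3))] -/
theorem LOT2003_thm7_fixedLength_towers_of_FP (h : LOT2003_thm7_fixedLength_towers_FP) :
    LOT2003_thm7_fixedLength_towers :=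
  LOT2003_thm7_fixedLength_towers_of_mem_FP h fun _ => rfl

/-! ### Sanity checks -/

/-- On the one-edge drawing of the pivot file (`N = 2`, `s = 0`, `t = 1`, one Hamiltonian path)
the instance of the tower step has exactly one walk of the prescribed length (non-vacuity of
`sawCountFixedLength_towerInstance` in the main case). [folklore] -/
theorem sawCountFixedLength_towerInstance_oneEdge :
    sawCountFixedLength (towerInstance oneEdgeDrawing.1 oneEdgeDrawing.2 0 1).1
        (towerInstance oneEdgeDrawing.1 oneEdgeDrawing.2 0 1).2.1
        (towerInstance oneEdgeDrawing.1 oneEdgeDrawing.2 0 1).2.2 = 1 := by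
  rw [sawCountFixedLength_towerInstance, GRIDHAMPATHCOUNT_encode _ _ _ _ isGridDrawing_oneEdge
    (by decide) (by decide)]
  exact hamPathCount_oneEdge

/-- The main case is the one taken on the one-edge drawing (its instance is the uniformised
drawing's, not one of the two fixed instances). [folklore] -/
theorem towerInstance_oneEdge :
    towerInstance oneEdgeDrawing.1 oneEdgeDrawing.2 0 1 =
      (translate (-(img (uniformize oneEdgeDrawing.1 oneEdgeDrawing.2).1 0))
          (drawnEdges (uniformize oneEdgeDrawing.1 oneEdgeDrawing.2).2),
        img (uniformize oneEdgeDrawing.1 oneEdgeDrawing.2).1 1 -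
          img (uniformize oneEdgeDrawing.1 oneEdgeDrawing.2).1 0,
        24 * maxEdges oneEdgeDrawing.2 * maxEdges oneEdgeDrawing.2 * (2 - 1)) :=
  towerInstance_of_ne_one _ _ _ _ ⟨isGridDrawing_oneEdge, by decide, by decide⟩ (by decide)

/-- On the code of a non-drawing (a diagonal "edge") the image has no walk: both sides of
`SAWCOUNT₁_towerCode` vanish. [folklore] -/
theorem SAWCOUNT₁_towerCode_diagonal :
    SAWCOUNT₁ (towerCode (encodingDrawnGraphInstance.encode
      ([((0 : ℤ), (0 : ℤ)), (1, 1)], [(0, 1, [((0 : ℤ), (0 : ℤ)), (1, 1)])], 0, 1))) = 0 := by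
  rw [SAWCOUNT₁_towerCode, GRIDHAMPATHCOUNT_encode_of_not _ _ _ _ not_isGridDrawing_diagonal]

end Literature.Barriers.CriticalPhenomena.GridSAW
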